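import Summits.AnomalousDissipation.AnomalousDissipation.Theorems.TaylorCertificatesKolmogorovFloorAssemblyResp
import Literature.Analysis.FunctionSpaces.TorusTrigPoly
import Literature.Analysis.FunctionSpaces.TorusWeightedGalerkinCoefficients

/-!
# ASSEMBLY of line `Sketch`, part 3: the residual of the linearised steady Euler equations
(crux stmt-AnomalousDissipation-15122; line lead)

The single-line coefficient function `lineFn`, the symbol `linOp` on sums and on a line, the triad forms of the force and of a
line site, the RESIDUAL IDENTITY on a line (components `ReC, RxC, RnC`), and its lattice representation summed over the forced modes.
-/

noncomputable section

set_option linter.dupNamespace false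

open Matrix Finset UnitAddTorus MeasureTheory
open scoped BigOperators ComplexConjugate InnerProductSpace ENNReal

namespace Summit.AnomalousDissipation.AnomalousDissipation.Theorems.KolmogorovFloor.Response

open Literature.Analysis.FunctionSpaces Literature.Analysis.FluidPDE

/-! ## Part 3: the residual of the linearised steady Euler equations, line by line and on the lattice -/

section Residual

variable {ξ e : Fin 3 → ℤ}

/-- The coefficient function of ONE mode line: `C^{(k)}(κ) = Σ_{m ∈ oddWindow J} [κ = k + mξ] c^{(k)}_m`. -/
def lineFn (ξ e k : Fin 3 → ℤ) (v : EuclideanSpace ℂ (Fin 3)) (J : ℕ) (κ : Fin 3 → ℤ) :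
    EuclideanSpace ℂ (Fin 3) :=
  ∑ m ∈ oddWindow J, if κ = k + m • ξ then lineCoeff ξ e k v J m else 0

/-- The response coefficient function is the sum of the line functions of the forced modes. -/
theorem respCoeff_eq_sum_lineFn (L : ℕ) (ξ e : Fin 3 → ℤ) (g : (Fin 3 → ℤ) → EuclideanSpace ℂ (Fin 3))
    (J : ℕ) (κ : Fin 3 → ℤ) : respCoeff L ξ e g J κ = ∑ k ∈ forcedModes L, lineFn ξ e k (g k) J κ := rfl

/-- Two sites of the same line coincide only for equal indices (`ξ ≠ 0`). -/
theorem lineSite_index_inj (hξ : ξ ≠ 0) (k : Fin 3 → ℤ) {m m' : ℤ} (h : k + m • ξ = k + m' • ξ) : m = m' := by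
  have h1 : (m - m') • ξ = 0 := by rw [sub_smul, sub_eq_zero]; exact add_left_cancel h
  rcases smul_eq_zero.1 h1 with h2 | h2
  · exact sub_eq_zero.1 h2
  · exact absurd h2 hξ

/-- Not a member of the odd window means: even, or beyond `2J+1` in absolute value. -/
theorem not_mem_oddWindow_iff {J : ℕ} {m : ℤ} : m ∉ oddWindow J ↔ (m % 2 = 0 ∨ 2 * (J : ℤ) + 1 < |m|) := by
  rw [mem_oddWindow]; omega

/-- **The line function at a line site** is the line coefficient there (for all `m₀`, given the support of `c`). -/
theorem lineFn_lineSite (hξ : ξ ≠ 0) {k : Fin 3 → ℤ} {v : EuclideanSpace ℂ (Fin 3)} {J : ℕ}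
    (hsupp : ∀ m : ℤ, m ∉ oddWindow J → lineCoeff ξ e k v J m = 0) (m₀ : ℤ) :
    lineFn ξ e k v J (k + m₀ • ξ) = lineCoeff ξ e k v J m₀ := by
  rw [lineFn]
  by_cases hm₀ : m₀ ∈ oddWindow J
  · rw [Finset.sum_eq_single_of_mem m₀ hm₀ fun m _ hm => if_neg fun h => hm (lineSite_index_inj hξ k h).symm]
    rw [if_pos rfl]
  · rw [hsupp m₀ hm₀]
    refine Finset.sum_eq_zero fun m hm => if_neg fun h => ?_
    exact hm₀ ((lineSite_index_inj hξ k h) ▸ hm)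

/-- Off its line, a line function vanishes. -/
theorem lineFn_eq_zero_of_not_onLine {k : Fin 3 → ℤ} {v : EuclideanSpace ℂ (Fin 3)} {J : ℕ} {κ : Fin 3 → ℤ}
    (h : ∀ m : ℤ, κ ≠ k + m • ξ) : lineFn ξ e k v J κ = 0 :=
  Finset.sum_eq_zero fun m _ => if_neg (h m)

/-! ### The linearised transport symbol on sums and on a line function -/

/-- `linOp` is additive in the coefficient function. -/
theorem linOp_add (ξ e : Fin 3 → ℤ) (C₁ C₂ : (Fin 3 → ℤ) → EuclideanSpace ℂ (Fin 3)) (κ : Fin 3 → ℤ) :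
    linOp ξ e (C₁ + C₂) κ = linOp ξ e C₁ κ + linOp ξ e C₂ κ := by
  simp only [linOp, Pi.add_apply, ipair_add]
  module

/-- `linOp` of the zero coefficient function. -/
theorem linOp_zero (ξ e : Fin 3 → ℤ) (κ : Fin 3 → ℤ) : linOp ξ e 0 κ = 0 := by
  simp [linOp]

/-- `linOp` commutes with finite sums of coefficient functions. -/
theorem linOp_sum {ι : Type*} (s : Finset ι) (ξ e : Fin 3 → ℤ) (C : ι → (Fin 3 → ℤ) → EuclideanSpace ℂ (Fin 3))
    (κ : Fin 3 → ℤ) : linOp ξ e (fun κ' => ∑ i ∈ s, C i κ') κ = ∑ i ∈ s, linOp ξ e (C i) κ := by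
  classical
  induction s using Finset.induction_on with
  | empty => simp only [Finset.sum_empty]; exact linOp_zero ξ e κ
  | insert a s ha ih =>
    rw [Finset.sum_insert ha, ← ih]
    have : (fun κ' => ∑ i ∈ insert a s, C i κ') = C a + fun κ' => ∑ i ∈ s, C i κ' := by
      funext κ'; rw [Finset.sum_insert ha]; rfl
    rw [this, linOp_add]

/-- The neighbours of a line site: `(k + mξ) − ξ = k + (m−1)ξ`. -/
theorem lineSite_sub (k ξ : Fin 3 → ℤ) (m : ℤ) : k + m • ξ - ξ = k + (m - 1) • ξ := by
  rw [sub_smul, one_smul]; abel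

/-- The neighbours of a line site: `(k + mξ) + ξ = k + (m+1)ξ`. -/
theorem lineSite_add (k ξ : Fin 3 → ℤ) (m : ℤ) : k + m • ξ + ξ = k + (m + 1) • ξ := by
  rw [add_smul, one_smul]; abel

/-- **`linOp` of a line function at a line site**:
`(𝓛 C^{(k)})(k + mξ) = πa (c_{m−1} − c_{m+1}) + π X2 (y_{m−1} + y_{m+1}) e`. -/
theorem linOp_lineFn_lineSite (h : ξ ⬝ᵥ e = 0) (hξ : ξ ≠ 0) {k : Fin 3 → ℤ} {v : EuclideanSpace ℂ (Fin 3)}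
    {J : ℕ} (hsupp : ∀ m : ℤ, m ∉ oddWindow J → lineCoeff ξ e k v J m = 0) (m : ℤ) :
    linOp ξ e (lineFn ξ e k v J) (k + m • ξ) =
      ((Real.pi : ℂ) * ((lineData k ξ e).a : ℂ)) • (lineCoeff ξ e k v J (m - 1) - lineCoeff ξ e k v J (m + 1))
        + ((Real.pi : ℂ) * ((yC (lineData k ξ e) (lineForce ξ e v) J (m - 1)
            + yC (lineData k ξ e) (lineForce ξ e v) J (m + 1)) * ((ξ ⬝ᵥ ξ : ℤ) : ℂ))) • Torus.freqVec e := by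
  rw [linOp, lineSite_sub, lineSite_add, lineFn_lineSite hξ hsupp, lineFn_lineSite hξ hsupp, lineSite_dot_e h,
    ipair_xi_lineCoeff h, ipair_xi_lineCoeff h, lineData_a, ← add_mul]

/-- Off its line, `linOp` of a line function vanishes. -/
theorem linOp_lineFn_eq_zero {k : Fin 3 → ℤ} {v : EuclideanSpace ℂ (Fin 3)} {J : ℕ} {κ : Fin 3 → ℤ}
    (hκ : ∀ m : ℤ, κ ≠ k + m • ξ) : linOp ξ e (lineFn ξ e k v J) κ = 0 := by
  have h1 : ∀ m : ℤ, κ - ξ ≠ k + m • ξ := fun m hm => hκ (m + 1) (by rw [← lineSite_add, ← hm, sub_add_cancel])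
  have h2 : ∀ m : ℤ, κ + ξ ≠ k + m • ξ := fun m hm => hκ (m - 1) (by rw [← lineSite_sub, ← hm, add_sub_cancel_right])
  rw [linOp, lineFn_eq_zero_of_not_onLine h1, lineFn_eq_zero_of_not_onLine h2]
  simp

/-! ### The residual identity on a line -/

/-- The force coefficient in the triad: `v = ve•e + vx•ξ + vn•n`. -/
theorem force_triad (h : ξ ⬝ᵥ e = 0) (he : e ⬝ᵥ e ≠ 0) (hX : ξ ⬝ᵥ ξ ≠ 0)
    (hn : cross3 ξ e ⬝ᵥ cross3 ξ e = (e ⬝ᵥ e) * (ξ ⬝ᵥ ξ)) (v : EuclideanSpace ℂ (Fin 3)) :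
    v = (lineForce ξ e v).ve • Torus.freqVec e + (lineForce ξ e v).vx • Torus.freqVec ξ
      + (lineForce ξ e v).vn • Torus.freqVec (cross3 ξ e) := by
  have key := triad_decomp_complex h v
  have he' : ((e ⬝ᵥ e : ℤ) : ℂ) ≠ 0 := by exact_mod_cast he
  have hX' : ((ξ ⬝ᵥ ξ : ℤ) : ℂ) ≠ 0 := by exact_mod_cast hX
  have hn' : ((cross3 ξ e ⬝ᵥ cross3 ξ e : ℤ) : ℂ) = ((e ⬝ᵥ e : ℤ) : ℂ) * ((ξ ⬝ᵥ ξ : ℤ) : ℂ) := by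
    exact_mod_cast hn
  have hne : (((e ⬝ᵥ e) * (ξ ⬝ᵥ ξ) : ℤ) : ℂ) ≠ 0 := by push_cast; exact mul_ne_zero he' hX'
  refine smul_right_injective (EuclideanSpace ℂ (Fin 3)) hne ?_
  dsimp only
  rw [key, smul_add, smul_add, smul_smul, smul_smul, smul_smul, lineForce_ve, lineForce_vx, lineForce_vn, hn']
  have s1 : (((e ⬝ᵥ e) * (ξ ⬝ᵥ ξ) : ℤ) : ℂ) * (ipair e v / ((e ⬝ᵥ e : ℤ) : ℂ)) = ipair e v * ((ξ ⬝ᵥ ξ : ℤ) : ℂ) := by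
    push_cast; field_simp
  have s2 : (((e ⬝ᵥ e) * (ξ ⬝ᵥ ξ) : ℤ) : ℂ) * (ipair ξ v / ((ξ ⬝ᵥ ξ : ℤ) : ℂ)) = ipair ξ v * ((e ⬝ᵥ e : ℤ) : ℂ) := by
    push_cast; field_simp
  have s3 : (((e ⬝ᵥ e) * (ξ ⬝ᵥ ξ) : ℤ) : ℂ) *
      (ipair (cross3 ξ e) v / (((e ⬝ᵥ e : ℤ) : ℂ) * ((ξ ⬝ᵥ ξ : ℤ) : ℂ))) = ipair (cross3 ξ e) v := by
    push_cast; field_simp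
  rw [s1, s2, s3]

/-- A line site in the triad: `k + mξ = (a/e2) e + (T_m/X2) ξ + (c/n2) n`. -/
theorem site_triad (h : ξ ⬝ᵥ e = 0) (he : e ⬝ᵥ e ≠ 0) (hX : ξ ⬝ᵥ ξ ≠ 0)
    (hn : cross3 ξ e ⬝ᵥ cross3 ξ e = (e ⬝ᵥ e) * (ξ ⬝ᵥ ξ)) (k : Fin 3 → ℤ) (m : ℤ) :
    Torus.freqVec (k + m • ξ) =
      (((lineData k ξ e).a : ℂ) / ((lineData k ξ e).e2 : ℂ)) • Torus.freqVec e
        + (((lineData k ξ e).T m : ℂ) / ((lineData k ξ e).X2 : ℂ)) • Torus.freqVec ξ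
        + (((lineData k ξ e).c : ℂ) / ((lineData k ξ e).n2 : ℂ)) • Torus.freqVec (cross3 ξ e) := by
  have key := triad_decomp h (k + m • ξ)
  rw [lineSite_dot_e h, lineSite_dot_xi ξ e k m, lineSite_dot_n ξ e k m] at key
  have he' : ((e ⬝ᵥ e : ℤ) : ℂ) ≠ 0 := by exact_mod_cast he
  have hX' : ((ξ ⬝ᵥ ξ : ℤ) : ℂ) ≠ 0 := by exact_mod_cast hX
  have hne : (((e ⬝ᵥ e) * (ξ ⬝ᵥ ξ) : ℤ) : ℂ) ≠ 0 := by push_cast; exact mul_ne_zero he' hX'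
  have keyC : (((e ⬝ᵥ e) * (ξ ⬝ᵥ ξ) : ℤ) : ℂ) • Torus.freqVec (k + m • ξ) =
      (((k ⬝ᵥ e) * (ξ ⬝ᵥ ξ) : ℤ) : ℂ) • Torus.freqVec e + ((((lineData k ξ e).T m) * (e ⬝ᵥ e) : ℤ) : ℂ) •
        Torus.freqVec ξ + ((k ⬝ᵥ cross3 ξ e : ℤ) : ℂ) • Torus.freqVec (cross3 ξ e) := by
    ext i
    have hi := congrFun key i
    simp only [Pi.smul_apply, Pi.add_apply, smul_eq_mul] at hi
    simp only [PiLp.add_apply, PiLp.smul_apply, smul_eq_mul, Torus.freqVec_apply, Pi.add_apply, Pi.smul_apply]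
    exact_mod_cast hi
  refine smul_right_injective (EuclideanSpace ℂ (Fin 3)) hne ?_
  dsimp only
  rw [keyC, smul_add, smul_add, smul_smul, smul_smul, smul_smul, lineData_a, lineData_c, lineData_e2, lineData_X2,
    lineData_n2, hn]
  have s1 : (((e ⬝ᵥ e) * (ξ ⬝ᵥ ξ) : ℤ) : ℂ) * (((k ⬝ᵥ e : ℤ) : ℂ) / ((e ⬝ᵥ e : ℤ) : ℂ)) =
      (((k ⬝ᵥ e) * (ξ ⬝ᵥ ξ) : ℤ) : ℂ) := by
    push_cast; field_simp
  have s2 : (((e ⬝ᵥ e) * (ξ ⬝ᵥ ξ) : ℤ) : ℂ) * ((((lineData k ξ e).T m : ℤ) : ℂ) / ((ξ ⬝ᵥ ξ : ℤ) : ℂ)) =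
      ((((lineData k ξ e).T m) * (e ⬝ᵥ e) : ℤ) : ℂ) := by
    push_cast; field_simp
  have s3 : (((e ⬝ᵥ e) * (ξ ⬝ᵥ ξ) : ℤ) : ℂ) *
      (((k ⬝ᵥ cross3 ξ e : ℤ) : ℂ) / (((e ⬝ᵥ e) * (ξ ⬝ᵥ ξ) : ℤ) : ℂ)) = ((k ⬝ᵥ cross3 ξ e : ℤ) : ℂ) := by
    field_simp
  rw [s1, s2, s3]

/-- **The residual identity on a line.** At every site `m`, the linearised steady Euler operator applied to the line
function, minus the force at `m = 0`, minus the pressure `q_m (k + mξ)`, has triad components `ReC_m, RxC_m, RnC_m`. -/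
theorem lineResidual_identity (h : ξ ⬝ᵥ e = 0) (hξ : ξ ≠ 0) (he : e ⬝ᵥ e ≠ 0) (hX : ξ ⬝ᵥ ξ ≠ 0)
    (hn : cross3 ξ e ⬝ᵥ cross3 ξ e = (e ⬝ᵥ e) * (ξ ⬝ᵥ ξ)) {k : Fin 3 → ℤ} {v : EuclideanSpace ℂ (Fin 3)} {J : ℕ}
    (hsupp : ∀ m : ℤ, m ∉ oddWindow J → lineCoeff ξ e k v J m = 0) (m : ℤ) :
    linOp ξ e (lineFn ξ e k v J) (k + m • ξ) - (if m = 0 then v else 0)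
        - qC (lineData k ξ e) (lineForce ξ e v) J m • Torus.freqVec (k + m • ξ) =
      ReC (lineData k ξ e) (lineForce ξ e v) J m • Torus.freqVec e
        + RxC (lineData k ξ e) (lineForce ξ e v) J m • Torus.freqVec ξ
        + RnC (lineData k ξ e) (lineForce ξ e v) J m • Torus.freqVec (cross3 ξ e) := by
  rw [linOp_lineFn_lineSite h hξ hsupp, site_triad h he hX hn k m]
  simp only [lineCoeff]
  set d := lineData k ξ e with hd
  set F := lineForce ξ e v with hF
  have hv : v = F.ve • Torus.freqVec e + F.vx • Torus.freqVec ξ + F.vn • Torus.freqVec (cross3 ξ e) := by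
    rw [hF]; exact force_triad h he hX hn v
  have hX2 : ((ξ ⬝ᵥ ξ : ℤ) : ℂ) = (d.X2 : ℂ) := by rw [hd]; rfl
  have he2 : (d.e2 : ℂ) = ((e ⬝ᵥ e : ℤ) : ℂ) := by rw [hd]; rfl
  by_cases hm : m = 0
  · subst hm
    rw [if_pos rfl, hv]
    simp only [ReC, RxC, RnC, if_true, hX2]
    module
  · rw [if_neg hm]
    simp only [ReC, RxC, RnC, if_neg hm, hX2]
    module

/-- Far from the window every residual component vanishes: for `2J+3 ≤ |m|` the neighbours `m ± 1` are outside
the window and so is the pressure. -/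
theorem residual_zero_far {d : LineData} {F : LineForce} {J : ℕ}
    (hC : ∀ m : ℤ, (m % 2 = 0 ∨ 2 * (J : ℤ) + 1 < |m|) → xC d F J m = 0 ∧ yC d F J m = 0 ∧ zC d F J m = 0)
    {m : ℤ} (hm : 2 * (J : ℤ) + 3 ≤ |m|) : ReC d F J m = 0 ∧ RxC d F J m = 0 ∧ RnC d F J m = 0 ∧ qC d F J m = 0 := by
  have ha1 : |m| - 1 ≤ |m - 1| := by
    have := abs_sub_abs_le_abs_sub m 1; rw [abs_one] at this; exact this
  have ha2 : |m| - 1 ≤ |m + 1| := by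
    have := abs_sub_abs_le_abs_sub m (-1); rw [abs_neg, abs_one, sub_neg_eq_add] at this; exact this
  have h1 := hC (m - 1) (Or.inr (by omega))
  have h2 := hC (m + 1) (Or.inr (by omega))
  have hm0 : m ≠ 0 := by intro h0; rw [h0] at hm; simp at hm; omega
  have hq : qC d F J m = 0 := by rw [qC, h1.2.1, h2.2.1]; simp
  refine ⟨?_, ?_, ?_, hq⟩
  · rw [ReC, h1.1, h2.1, h1.2.1, h2.2.1, hq, if_neg hm0]; simp
  · rw [RxC, h1.2.1, h2.2.1, hq, if_neg hm0]; simp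
  · rw [RnC, h1.2.2, h2.2.2, hq, if_neg hm0]; simp

/-- The pressure symbol vanishes beyond `|m| ≥ 2J+3`. -/
theorem qC_zero_far {d : LineData} {F : LineForce} {J : ℕ}
    (hC : ∀ m : ℤ, (m % 2 = 0 ∨ 2 * (J : ℤ) + 1 < |m|) → xC d F J m = 0 ∧ yC d F J m = 0 ∧ zC d F J m = 0)
    {m : ℤ} (hm : 2 * (J : ℤ) + 3 ≤ |m|) : qC d F J m = 0 :=
  (residual_zero_far hC hm).2.2.2

/-- Support of the line coefficients from the support of the scalar sequences. -/
theorem lineCoeff_zero_of_not_mem {k : Fin 3 → ℤ} {v : EuclideanSpace ℂ (Fin 3)} {J : ℕ}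
    (hC : ∀ m : ℤ, (m % 2 = 0 ∨ 2 * (J : ℤ) + 1 < |m|) →
      xC (lineData k ξ e) (lineForce ξ e v) J m = 0 ∧ yC (lineData k ξ e) (lineForce ξ e v) J m = 0 ∧
        zC (lineData k ξ e) (lineForce ξ e v) J m = 0)
    (m : ℤ) (hm : m ∉ oddWindow J) : lineCoeff ξ e k v J m = 0 := by
  obtain ⟨hx, hy, hz⟩ := hC m (not_mem_oddWindow_iff.1 hm)
  rw [lineCoeff, hx, hy, hz]; simp

/-- **The residual of a line, represented on the lattice.** With the big window `|m| ≤ 2J+2` (which carries the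
force site `m = 0`, the response sites and the two edge sites):
`𝓛C^{(k)}(κ) − [κ = k] v − (Σ_m [κ = k + mξ] q_m) κ = Σ_m [κ = k + mξ] (ReC_m e + RxC_m ξ + RnC_m n)`. -/
theorem lineResidual_repr (h : ξ ⬝ᵥ e = 0) (hξ : ξ ≠ 0) (he : e ⬝ᵥ e ≠ 0) (hX : ξ ⬝ᵥ ξ ≠ 0)
    (hn : cross3 ξ e ⬝ᵥ cross3 ξ e = (e ⬝ᵥ e) * (ξ ⬝ᵥ ξ)) {k : Fin 3 → ℤ} {v : EuclideanSpace ℂ (Fin 3)} {J : ℕ}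
    (hC : ∀ m : ℤ, (m % 2 = 0 ∨ 2 * (J : ℤ) + 1 < |m|) →
      xC (lineData k ξ e) (lineForce ξ e v) J m = 0 ∧ yC (lineData k ξ e) (lineForce ξ e v) J m = 0 ∧
        zC (lineData k ξ e) (lineForce ξ e v) J m = 0)
    (κ : Fin 3 → ℤ) :
    linOp ξ e (lineFn ξ e k v J) κ - (if κ = k then v else 0)
        - (∑ m ∈ Finset.Icc (-(2 * (J : ℤ) + 2)) (2 * (J : ℤ) + 2),
            if κ = k + m • ξ then qC (lineData k ξ e) (lineForce ξ e v) J m else 0) • Torus.freqVec κ =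
      ∑ m ∈ Finset.Icc (-(2 * (J : ℤ) + 2)) (2 * (J : ℤ) + 2),
        if κ = k + m • ξ then
          (ReC (lineData k ξ e) (lineForce ξ e v) J m • Torus.freqVec e
            + RxC (lineData k ξ e) (lineForce ξ e v) J m • Torus.freqVec ξ
            + RnC (lineData k ξ e) (lineForce ξ e v) J m • Torus.freqVec (cross3 ξ e))
        else 0 := by
  have hsupp := lineCoeff_zero_of_not_mem (ξ := ξ) (e := e) hC
  by_cases hκ : ∃ m₀ : ℤ, κ = k + m₀ • ξ
  · obtain ⟨m₀, rfl⟩ := hκ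
    -- collapse the two indicator sums to the single site `m₀`
    have hsingle : ∀ (G : ℤ → EuclideanSpace ℂ (Fin 3)) (hG : 2 * (J : ℤ) + 3 ≤ |m₀| → G m₀ = 0),
        (∑ m ∈ Finset.Icc (-(2 * (J : ℤ) + 2)) (2 * (J : ℤ) + 2),
          if k + m₀ • ξ = k + m • ξ then G m else 0) = G m₀ := by
      intro G hG
      by_cases hm₀ : m₀ ∈ Finset.Icc (-(2 * (J : ℤ) + 2)) (2 * (J : ℤ) + 2)
      · rw [Finset.sum_eq_single_of_mem m₀ hm₀ fun m _ hm => if_neg fun h' => hm (lineSite_index_inj hξ k h').symm,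
          if_pos rfl]
      · rw [hG (by rw [Finset.mem_Icc] at hm₀; have := le_abs_self m₀; have := neg_abs_le m₀; omega)]
        exact Finset.sum_eq_zero fun m hm => if_neg fun h' => hm₀ (by rw [lineSite_index_inj hξ k h']; exact hm)
    have hsingleC : ∀ (G : ℤ → ℂ) (hG : 2 * (J : ℤ) + 3 ≤ |m₀| → G m₀ = 0),
        (∑ m ∈ Finset.Icc (-(2 * (J : ℤ) + 2)) (2 * (J : ℤ) + 2),
          if k + m₀ • ξ = k + m • ξ then G m else 0) = G m₀ := by
      intro G hG
      by_cases hm₀ : m₀ ∈ Finset.Icc (-(2 * (J : ℤ) + 2)) (2 * (J : ℤ) + 2)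
      · rw [Finset.sum_eq_single_of_mem m₀ hm₀ fun m _ hm => if_neg fun h' => hm (lineSite_index_inj hξ k h').symm,
          if_pos rfl]
      · rw [hG (by rw [Finset.mem_Icc] at hm₀; have := le_abs_self m₀; have := neg_abs_le m₀; omega)]
        exact Finset.sum_eq_zero fun m hm => if_neg fun h' => hm₀ (by rw [lineSite_index_inj hξ k h']; exact hm)
    rw [hsingleC _ fun hfar => qC_zero_far hC hfar]
    rw [hsingle _ fun hfar => by
      obtain ⟨h1, h2, h3, -⟩ := residual_zero_far hC hfar
      rw [h1, h2, h3]; simp]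
    have hk0 : (k + m₀ • ξ = k) ↔ m₀ = 0 := by
      constructor
      · intro h'
        exact lineSite_index_inj hξ k (by rw [h', zero_smul, add_zero])
      · intro h'; rw [h', zero_smul, add_zero]
    by_cases hm0 : m₀ = 0
    · rw [if_pos (hk0.2 hm0)]
      have := lineResidual_identity h hξ he hX hn hsupp m₀
      rw [if_pos hm0] at this
      exact this
    · rw [if_neg (fun h' => hm0 (hk0.1 h'))]
      have := lineResidual_identity h hξ he hX hn hsupp m₀
      rw [if_neg hm0] at this
      exact this
  · push Not at hκ
    rw [linOp_lineFn_eq_zero hκ, if_neg (fun h' => hκ 0 (by rw [h', zero_smul, add_zero])),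
      Finset.sum_eq_zero fun m _ => if_neg (hκ m), Finset.sum_eq_zero fun m _ => if_neg (hκ m)]
    simp

/-- **The residual of the whole response, represented on the lattice**: summing `lineResidual_repr` over the
forced modes, `𝓛C(κ) − [κ forced] ĝ(κ) − q(κ) κ = Σ_k Σ_{|m| ≤ 2J+2} [κ = k + mξ] (ReC e + RxC ξ + RnC n)`. -/
theorem latticeResidual_repr (h : ξ ⬝ᵥ e = 0) (hξ : ξ ≠ 0) (he : e ⬝ᵥ e ≠ 0) (hX : ξ ⬝ᵥ ξ ≠ 0)
    (hn : cross3 ξ e ⬝ᵥ cross3 ξ e = (e ⬝ᵥ e) * (ξ ⬝ᵥ ξ)) {L J : ℕ} {g : (Fin 3 → ℤ) → EuclideanSpace ℂ (Fin 3)}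
    (hC : ∀ k ∈ forcedModes L, ∀ m : ℤ, (m % 2 = 0 ∨ 2 * (J : ℤ) + 1 < |m|) →
      xC (lineData k ξ e) (lineForce ξ e (g k)) J m = 0 ∧ yC (lineData k ξ e) (lineForce ξ e (g k)) J m = 0 ∧
        zC (lineData k ξ e) (lineForce ξ e (g k)) J m = 0)
    (κ : Fin 3 → ℤ) :
    linOp ξ e (respCoeff L ξ e g J) κ - (if κ ∈ forcedModes L then g κ else 0)
        - (∑ k ∈ forcedModes L, ∑ m ∈ Finset.Icc (-(2 * (J : ℤ) + 2)) (2 * (J : ℤ) + 2),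
            if κ = k + m • ξ then qC (lineData k ξ e) (lineForce ξ e (g k)) J m else 0) • Torus.freqVec κ =
      ∑ k ∈ forcedModes L, ∑ m ∈ Finset.Icc (-(2 * (J : ℤ) + 2)) (2 * (J : ℤ) + 2),
        if κ = k + m • ξ then
          (ReC (lineData k ξ e) (lineForce ξ e (g k)) J m • Torus.freqVec e
            + RxC (lineData k ξ e) (lineForce ξ e (g k)) J m • Torus.freqVec ξ
            + RnC (lineData k ξ e) (lineForce ξ e (g k)) J m • Torus.freqVec (cross3 ξ e))
        else 0 := by
  have hfun : respCoeff L ξ e g J = fun κ' => ∑ k ∈ forcedModes L, lineFn ξ e k (g k) J κ' := rfl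
  rw [hfun, linOp_sum, Finset.sum_smul, ← Finset.sum_ite_eq (forcedModes L) κ (fun k => g k),
    ← Finset.sum_sub_distrib, ← Finset.sum_sub_distrib]
  exact Finset.sum_congr rfl fun k hk => lineResidual_repr h hξ he hX hn (hC k hk) κ

end Residual

end Summit.AnomalousDissipation.AnomalousDissipation.Theorems.KolmogorovFloor.Response
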